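import Summits.Parity.GeneralizedHardyLittlewood.Theorems.BeyondDiagonalBeatsQuarter.OffDiagBlockStrata
import HarnessLib

/-!
# Route `PrimeLevelFamEdge`, crux K_B (stmt-Parity-20343), line `diagonal_kernel_split` rev 4, plan Ω,
# L7d leaf **D5c — `OffDiagCoreUnitLevels`: the unit-level correction** (L7D-PLAN §3 D5c)

In a switched cell of `OffDiagCoreSplit` the dual modulus `h₁` carries the indicator `𝟙[h₁ unit mod q(r+1)]`, which
depends on the level `q`. For a prime level it splits as `𝟙[(h₁, r+1) = 1]·(1 − 𝟙[q ∣ h₁])`: a `q`-FREE indicator minus the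
correction supported on the multiples of `q`, of which there are at most `2⌊H/q⌋` in `0 < |h₁| ≤ H` — on the balanced boxes
(`H ≤ H₁* ≲ N`) a handful per level, so the correction is a trivially small family (its ms-currency total rides with D7b).

* **`isUnit_level_iff_not_dvd`** — `q` prime: `IsUnit (h₁ mod q·c) ↔ IsUnit (h₁ mod c) ∧ ¬ q ∣ h₁`
  (`OffDiagBlockStrata.isUnit_intCast_zmod_mul_iff`);
* `ite_isUnit_level_eq_sub` — the indicator identity `𝟙[unit mod qc]·x = 𝟙[unit mod c]·x − 𝟙[unit mod c ∧ q ∣ h₁]·x`;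
* **`card_filter_Icc_dvd_ne_zero_le`** — `#{h₁ ∈ [−H, H] : q ∣ h₁, h₁ ≠ 0} ≤ 2·(H/q)` (`q ≥ 1`);
* `sum_filter_dvd_ne_zero_norm_le` — `Σ_{h₁ ∈ [−H,H], q∣h₁, h₁≠0} ‖F h₁‖ ≤ 2(H/q)·B` when `‖F‖ ≤ B`.

Counting only; helper; closes nothing; no definitions; standard axioms. «The programme SEARCHES and TYPES; no claim about
Landau–Siegel zeros, Theorems 1–2 of arXiv:2211.02515 or a repaired Margin232 until a kernel theorem says so.»
-/

noncomputable section

open Finset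

namespace Summit.Parity.GeneralizedHardyLittlewood.Theorems.BeyondDiagonalBeatsQuarter.OffDiag

/-! ### The unit indicator at a prime level -/

/-- For a prime `q`: `(h₁, q) = 1 ↔ q ∤ h₁`. [folklore] -/
theorem isCoprime_natCast_prime_iff_not_dvd {q : ℕ} (hq : q.Prime) (h₁ : ℤ) :
    IsCoprime h₁ (q : ℤ) ↔ ¬ (q : ℤ) ∣ h₁ := by
  rw [isCoprime_natCast_iff_gcd_eq_one, Int.gcd_comm, Int.gcd_eq_natAbs, Int.natAbs_natCast,
    ← Nat.coprime_iff_gcd_eq_one, Nat.Prime.coprime_iff_not_dvd hq, Int.natCast_dvd]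

/-- **The level indicator splits**: for a prime `q`, any `c` and `h₁`,
`IsUnit (h₁ : ZMod (q·c)) ↔ IsUnit (h₁ : ZMod c) ∧ ¬ q ∣ h₁`. [folklore] -/
theorem isUnit_level_iff_not_dvd {q : ℕ} (hq : q.Prime) (c : ℕ) (h₁ : ℤ) :
    IsUnit ((h₁ : ℤ) : ZMod (q * c)) ↔ IsUnit ((h₁ : ℤ) : ZMod c) ∧ ¬ (q : ℤ) ∣ h₁ := by
  rw [isUnit_intCast_zmod_mul_iff, ZMod.coe_int_isUnit_iff_isCoprime, isCoprime_natCast_prime_iff_not_dvd hq]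
  constructor
  · rintro ⟨h1, h2⟩
    exact ⟨h2.symm, h1⟩
  · rintro ⟨h1, h2⟩
    exact ⟨h2, h1.symm⟩

open Classical in
/-- **Indicator form**: `𝟙[h₁ unit mod q·c]·x = 𝟙[h₁ unit mod c]·x − 𝟙[h₁ unit mod c ∧ q ∣ h₁]·x` for a prime `q`.
[folklore] -/
theorem ite_isUnit_level_eq_sub {q : ℕ} (hq : q.Prime) (c : ℕ) (h₁ : ℤ) (x : ℂ) :
    (if IsUnit ((h₁ : ℤ) : ZMod (q * c)) then x else 0) =
      (if IsUnit ((h₁ : ℤ) : ZMod c) then x else 0) -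
        (if IsUnit ((h₁ : ℤ) : ZMod c) ∧ (q : ℤ) ∣ h₁ then x else 0) := by
  have hiff := isUnit_level_iff_not_dvd hq c h₁
  by_cases hu : IsUnit ((h₁ : ℤ) : ZMod c) <;> by_cases hd : (q : ℤ) ∣ h₁
  · have h1 : ¬ IsUnit ((h₁ : ℤ) : ZMod (q * c)) := fun h => (hiff.mp h).2 hd
    simp [h1, hu, hd]
  · have h1 : IsUnit ((h₁ : ℤ) : ZMod (q * c)) := hiff.mpr ⟨hu, hd⟩
    simp [h1, hu, hd]
  · have h1 : ¬ IsUnit ((h₁ : ℤ) : ZMod (q * c)) := fun h => hu (hiff.mp h).1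
    simp [h1, hu]
  · have h1 : ¬ IsUnit ((h₁ : ℤ) : ZMod (q * c)) := fun h => hu (hiff.mp h).1
    simp [h1, hu]

/-! ### Counting the multiples of the level in the dual range -/

/-- The nonzero integers of `[−K, K]` number `2K`. [folklore] -/
theorem card_filter_Icc_ne_zero (K : ℕ) :
    ((Icc (-(K : ℤ)) (K : ℤ)).filter (fun k : ℤ => k ≠ 0)).card = 2 * K := by
  have h0 : (0 : ℤ) ∈ Icc (-(K : ℤ)) (K : ℤ) := by simp
  have h1 : (Icc (-(K : ℤ)) (K : ℤ)).filter (fun k : ℤ => k ≠ 0) = (Icc (-(K : ℤ)) (K : ℤ)).erase 0 := by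
    ext k
    simp [Finset.mem_erase, and_comm]
  rw [h1, Finset.card_erase_of_mem h0, Int.card_Icc]
  omega

/-- **Multiples of `q` in the dual range**: for `q ≥ 1`, `#{h₁ ∈ [−H, H] : q ∣ h₁, h₁ ≠ 0} ≤ 2·⌊H/q⌋`
(`h₁ = q·h′` with `0 < |h′| ≤ H/q`). [folklore] -/
theorem card_filter_Icc_dvd_ne_zero_le {q : ℕ} (hq : 1 ≤ q) (H : ℕ) :
    ((Icc (-(H : ℤ)) (H : ℤ)).filter (fun h₁ : ℤ => (q : ℤ) ∣ h₁ ∧ h₁ ≠ 0)).card ≤ 2 * (H / q) := by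
  have hq0 : (0 : ℤ) < q := by exact_mod_cast hq
  rw [← card_filter_Icc_ne_zero (H / q)]
  refine Finset.card_le_card_of_injOn (fun h₁ : ℤ => h₁ / q) (fun h₁ hh₁ => ?_) ?_
  · simp only [Finset.coe_filter, Finset.mem_Icc, Set.mem_setOf_eq] at hh₁ ⊢
    obtain ⟨⟨hlo, hhi⟩, ⟨k, rfl⟩, hne⟩ := hh₁
    rw [Int.mul_ediv_cancel_left _ hq0.ne']
    have hk : k ≠ 0 := fun h => hne (by rw [h, mul_zero])
    -- `|q k| ≤ H ⇒ |k| ≤ H / q`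
    have habs : (q : ℤ) * |k| ≤ H := by
      rw [← abs_of_pos hq0, ← abs_mul]
      exact abs_le.mpr ⟨hlo, hhi⟩
    have hk' : |k| ≤ ((H / q : ℕ) : ℤ) := by
      rw [Int.natCast_div]
      exact Int.le_ediv_of_mul_le hq0 (by rw [mul_comm]; exact habs)
    exact ⟨⟨by linarith [neg_abs_le k], (le_abs_self k).trans hk'⟩, hk⟩
  · intro a ha b hb hab
    simp only [Finset.coe_filter, Set.mem_setOf_eq] at ha hb
    obtain ⟨ka, rfl⟩ := ha.2.1
    obtain ⟨kb, rfl⟩ := hb.2.1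
    simp only [Int.mul_ediv_cancel_left _ hq0.ne'] at hab
    rw [hab]

/-- **The unit-level correction is a small family**: for `q ≥ 1`, a bound `‖F h₁‖ ≤ B` on the dual range gives
`Σ_{h₁ ∈ [−H,H], q ∣ h₁, h₁ ≠ 0} ‖F h₁‖ ≤ 2·(H/q)·B`. [folklore] -/
theorem sum_filter_dvd_ne_zero_norm_le {q : ℕ} (hq : 1 ≤ q) (H : ℕ) {F : ℤ → ℂ} {B : ℝ}
    (hF : ∀ h₁ ∈ Icc (-(H : ℤ)) (H : ℤ), ‖F h₁‖ ≤ B) :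
    ∑ h₁ ∈ (Icc (-(H : ℤ)) (H : ℤ)).filter (fun h₁ : ℤ => (q : ℤ) ∣ h₁ ∧ h₁ ≠ 0), ‖F h₁‖ ≤
      2 * ((H / q : ℕ) : ℝ) * B := by
  have hB : ∀ h₁ ∈ (Icc (-(H : ℤ)) (H : ℤ)).filter (fun h₁ : ℤ => (q : ℤ) ∣ h₁ ∧ h₁ ≠ 0), ‖F h₁‖ ≤ B :=
    fun h₁ hh₁ => hF h₁ (Finset.mem_filter.1 hh₁).1
  calc ∑ h₁ ∈ (Icc (-(H : ℤ)) (H : ℤ)).filter (fun h₁ : ℤ => (q : ℤ) ∣ h₁ ∧ h₁ ≠ 0), ‖F h₁‖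
      ≤ ∑ h₁ ∈ (Icc (-(H : ℤ)) (H : ℤ)).filter (fun h₁ : ℤ => (q : ℤ) ∣ h₁ ∧ h₁ ≠ 0), B := Finset.sum_le_sum hB
    _ = (((Icc (-(H : ℤ)) (H : ℤ)).filter (fun h₁ : ℤ => (q : ℤ) ∣ h₁ ∧ h₁ ≠ 0)).card : ℝ) * B := by
        rw [Finset.sum_const, nsmul_eq_mul]
    _ ≤ 2 * ((H / q : ℕ) : ℝ) * B := by
        have hB0 : 0 ≤ B := (norm_nonneg _).trans (hF 0 (by simp))
        exact mul_le_mul_of_nonneg_right (by exact_mod_cast card_filter_Icc_dvd_ne_zero_le hq H) hB0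

end Summit.Parity.GeneralizedHardyLittlewood.Theorems.BeyondDiagonalBeatsQuarter.OffDiag

end
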